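import Summits.Parity.GeneralizedHardyLittlewood.Theorems.FordMaynardSieveConst01651SieveConst01651StarSplit
import HarnessLib

/-!
# Route `FordMaynardSieveConst01651`, target `SieveConst01651` (stmt-Parity-19185), line `sieve_decomposition`,
# stub `stub_coneCertClosed`: tail bounds for the kernels `F_m` and the box slice functions

Helper file (def-free), continuation of `…SliceKernel` / `…StarSplit` (K. Ford, J. Maynard, *On the theory of prime
producing sieves*, arXiv:2407.14368, §8.2).  Ford–Maynard discard the high-dimensional terms of `C = 1 + I₃ + ⋯ + I₆`
by volume bounds ("`|I₆| ≤ (15/ν⁶)·vol = 15(1−6ν)⁵/(5!6!ν⁶) < 10⁻¹²`", "`|I₅'| < 3·10⁻⁷`", p. 48).  The same device for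
the kernel normal form: on the slice `|v| = w` with all `vᵢ > ν` the `d` free coordinates lie in the cube
`(ν, w − dν)^d`, so

* `abs_sliceIntegral_box_le` — `|∫_{|v|=w} 𝟙[vᵢ>ν] H(v)/∏ vᵢ| ≤ (C/ν^{d+1})·(w − (d+1)ν)^d` for `|H| ≤ C` and
  `(d+1)ν ≤ w` (below that threshold the integral vanishes, `kernel_eq_zero_of_le` / the support of the box);
* `kernel_abs_le` — `|F_{d+1}(w)| ≤ (w − (d+1)ν)^d/ν^{d+1}`: e.g. at `ν = 0.1651`, `F₆(1) ≤ (0.0094)⁵/ν⁶ < 4·10⁻⁶` and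
  `F₅(s) ≤ (s − 5ν)⁴/ν⁵` vanishes to fourth order at `s = 5ν = 0.8255`.

References: [FordMaynard2024PrimeSieves] arXiv:2407.14368, §8.2 (bounds for I₅', I₆), §4.2.
-/

noncomputable section

open MeasureTheory Set Finset
open scoped Classical
open Literature.NumberTheory.Sieve Literature.NumberTheory.Sieve.FordMaynard

namespace Summit.Parity.GeneralizedHardyLittlewood.FordMaynardSieveConst01651SieveConst01651

/-- On the slice `|v| = w`, if all coordinates of `v = (u, w − |u|)` exceed `ν` then every free coordinate lies in
`(ν, w − dν)`. [folklore] -/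
theorem mem_cube_of_box_snoc {d : ℕ} {ν w : ℝ} {u : Fin d → ℝ}
    (hbox : ∀ i : Fin (d + 1), ν < (Fin.snoc u (w - ∑ j, u j) : Fin (d + 1) → ℝ) i) :
    u ∈ Set.pi Set.univ (fun _ : Fin d => Set.Ioo ν (w - d * ν)) := by
  rw [Set.mem_univ_pi]
  have hu : ∀ j : Fin d, ν < u j := fun j => by simpa using hbox (Fin.castSucc j)
  have hlast : ν < w - ∑ j, u j := by simpa using hbox (Fin.last d)
  intro i
  refine ⟨hu i, ?_⟩
  -- `∑ u ≥ u i + (d - 1) ν`, hence `u i < w - ν - (d-1) ν = w - d ν`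
  have hsplit : ∑ j, u j = u i + ∑ j ∈ Finset.univ.erase i, u j :=
    (Finset.add_sum_erase _ _ (Finset.mem_univ i)).symm
  have hrest : ((Finset.univ.erase i).card : ℝ) * ν ≤ ∑ j ∈ Finset.univ.erase i, u j := by
    calc ((Finset.univ.erase i).card : ℝ) * ν = ∑ _j ∈ Finset.univ.erase i, ν := by
          rw [Finset.sum_const, nsmul_eq_mul]
      _ ≤ ∑ j ∈ Finset.univ.erase i, u j := Finset.sum_le_sum fun j _ => (hu j).le
  have hcard : ((Finset.univ.erase i).card : ℝ) = (d : ℝ) - 1 := by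
    rw [Finset.card_erase_of_mem (Finset.mem_univ i), Finset.card_univ, Fintype.card_fin]
    have : 1 ≤ d := by
      rcases d with _ | d
      · exact absurd i.2 (by simp)
      · omega
    rw [Nat.cast_sub this, Nat.cast_one]
  rw [hcard] at hrest
  linarith

/-- **Volume bound for box slice integrals.** For `ν > 0`, `(d+1)ν ≤ w` and `|H| ≤ C`,
`|∫_{|v| = w} 𝟙[vᵢ > ν ∀ i]·H(v)/∏ vᵢ dv| ≤ (C/ν^{d+1})·(w − (d+1)ν)^d` (the free coordinates range over the cube
`(ν, w − dν)^d`, the integrand is at most `C/ν^{d+1}`). [cite: FordMaynard2024PrimeSieves, §8.2 (the bounds for I₅', I₆)] -/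
theorem abs_sliceIntegral_box_le (d : ℕ) {ν : ℝ} (hν : 0 < ν) {w : ℝ} (hw : (d + 1) * ν ≤ w)
    (H : (Fin (d + 1) → ℝ) → ℝ) {C : ℝ} (hC : 0 ≤ C) (hHb : ∀ v, |H v| ≤ C) :
    |sliceIntegral (d + 1) w (fun v => if ∀ i, ν < v i then H v / ∏ i, v i else 0)| ≤
      C / ν ^ (d + 1) * (w - (d + 1) * ν) ^ d := by
  set G : (Fin (d + 1) → ℝ) → ℝ := fun v => if ∀ i, ν < v i then H v / ∏ i, v i else 0 with hGdef
  rw [sliceIntegral_succ_eq]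
  set cube : Set (Fin d → ℝ) := Set.pi Set.univ (fun _ : Fin d => Set.Ioo ν (w - d * ν)) with hcube
  have hsupp : ∀ u, u ∉ cube → sliceIntegrand d w G u = 0 := by
    intro u hu
    unfold sliceIntegrand
    split_ifs with hc
    · simp only [hGdef]
      rw [if_neg]
      intro hbox
      exact hu (mem_cube_of_box_snoc hbox)
    · rfl
  have heq : ∫ u, sliceIntegrand d w G u = ∫ u in cube, sliceIntegrand d w G u := by
    rw [← integral_indicator (MeasurableSet.univ_pi fun _ => measurableSet_Ioo)]
    refine integral_congr_ae (Filter.Eventually.of_forall fun u => ?_)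
    by_cases hu : u ∈ cube
    · rw [Set.indicator_of_mem hu]
    · rw [Set.indicator_of_notMem hu, hsupp u hu]
  rw [heq]
  have hside : 0 ≤ w - (d + 1) * ν := by linarith
  have hvol : volume cube = ENNReal.ofReal ((w - (d + 1) * ν) ^ d) := by
    rw [hcube, Real.volume_pi_Ioo]
    simp only [Finset.prod_const, Finset.card_univ, Fintype.card_fin]
    rw [show w - (d : ℝ) * ν - ν = w - (d + 1) * ν by ring, ENNReal.ofReal_pow hside]
  have hfin : volume cube < ⊤ := by rw [hvol]; exact ENNReal.ofReal_lt_top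
  have hC' : 0 ≤ C / ν ^ (d + 1) := by positivity
  have hGb : ∀ v : Fin (d + 1) → ℝ, (∀ i, 0 < v i) → ∑ i, v i = w → |G v| ≤ C / ν ^ (d + 1) :=
    fun v _ _ => abs_boxIntegrand_le hν hC hHb v
  have := norm_setIntegral_le_of_norm_le_const hfin
    (fun u _ => (Real.norm_eq_abs _).le.trans (abs_sliceIntegrand_le d w hC' hGb u))
  rw [Real.norm_eq_abs] at this
  simpa only [Measure.real, hvol, ENNReal.toReal_ofReal (pow_nonneg hside d)] using this

/-- **Kernel tail bound `|F_{d+1}(w)| ≤ (w − (d+1)ν)^d/ν^{d+1}`** for `(d+1)ν ≤ w` (and `F_{d+1}(w) = 0` below,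
`kernel_eq_zero_of_le`).  E.g. `ν = 0.1651`: `F₆(1) ≤ 0.0094⁵/ν⁶ < 4·10⁻⁶`.
[cite: FordMaynard2024PrimeSieves, §8.2 (|I₆| bound)] -/
theorem kernel_abs_le (d : ℕ) {ν : ℝ} (hν : 0 < ν) {w : ℝ} (hw : (d + 1) * ν ≤ w) :
    |sliceIntegral (d + 1) w (fun u => if ∀ i, ν < u i then 1 / ∏ i, u i else 0)| ≤
      (w - (d + 1) * ν) ^ d / ν ^ (d + 1) := by
  have h := abs_sliceIntegral_box_le d hν hw (fun _ => (1 : ℝ)) zero_le_one (fun _ => by simp)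
  simpa [div_eq_inv_mul, mul_comm] using h

/-- **Tail bound for the ordered slice functions**: if `|g₀,_{d+1}| ≤ C` then
`|S⁰_{d+1}(t)| ≤ (C/ν^{d+1})·(t − (d+1)ν)^d` for `(d+1)ν ≤ t`.
[cite: FordMaynard2024PrimeSieves, §8.2 (|I₅'| bound)] -/
theorem sliceFnOrd_abs_le (d : ℕ) {ν : ℝ} (hν : 0 < ν) {t : ℝ} (ht : (d + 1) * ν ≤ t) (g₀ : VecFn) {C : ℝ}
    (hC : 0 ≤ C) (hgb : ∀ v, |g₀ (d + 1) v| ≤ C) :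
    |sliceIntegral (d + 1) t
        (fun v => if (∀ i, ν < v i) ∧ Monotone v then g₀ (d + 1) v / ∏ i, v i else 0)| ≤
      C / ν ^ (d + 1) * (t - (d + 1) * ν) ^ d := by
  have hH : ∀ v, |(if Monotone v then g₀ (d + 1) v else 0)| ≤ C := fun v => by
    split_ifs
    · exact hgb v
    · rw [abs_zero]; exact hC
  have h := abs_sliceIntegral_box_le d hν ht (fun v => if Monotone v then g₀ (d + 1) v else 0) hC hH
  have heq : sliceIntegral (d + 1) t
      (fun v => if (∀ i, ν < v i) ∧ Monotone v then g₀ (d + 1) v / ∏ i, v i else 0) =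
      sliceIntegral (d + 1) t
        (fun v => if ∀ i, ν < v i then (if Monotone v then g₀ (d + 1) v else 0) / ∏ i, v i else 0) := by
    congr 1
    funext v
    by_cases hb : ∀ i, ν < v i
    · by_cases hm : Monotone v
      · rw [if_pos ⟨hb, hm⟩, if_pos hb, if_pos hm]
      · rw [if_neg (fun h => hm h.2), if_pos hb, if_neg hm, zero_div]
    · rw [if_neg (fun h => hb h.1), if_neg hb]
  rw [heq]
  exact h

end Summit.Parity.GeneralizedHardyLittlewood.FordMaynardSieveConst01651SieveConst01651

end
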